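import Summits.HubbardSuperconductivity.HubbardSuperconductivity.Theses.JosephsonMirror
import Summits.HubbardSuperconductivity.HubbardSuperconductivity.Theorems.JosephsonMirrorThermofieldDouble
import Summits.HubbardSuperconductivity.HubbardSuperconductivity.Theorems.JosephsonMirrorPairBridgeGivesGain

/-!
# Route `JosephsonMirror` — crux `JmCusp` (stmt-HubbardSuperconductivity-2228): the thermofield bridge

Helper file (`--supports` stmt-HubbardSuperconductivity-2228) for route `JosephsonMirror` (sub-problem
`HubbardSuperconductivity`): the Hubbard specialisation of the thermofield double
(`Theorems/JosephsonMirrorThermofieldDouble`), i.e. the kernel-checked LINE of the crux idea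
`thermofield-double-purification` (`Cruxes/JmCusp/Ideas/thermofield-double-purification.md`; typed transfer
`TfdColdCoherenceAt` / line `TfdLine` of `Cruxes/JmCusp/SketchIdeator2.lean`):

* `josephsonGain_of_coldPairCoherence` — COLD IMAGINARY-TIME `d`-WAVE PAIR COHERENCE OF ONE LAYER GIVES
  CLAUSE (i) OF THE BET.  Fix `U, δ ∈ (0, 1/2), a > 0`.  If along some cold schedule `β_L → ∞` the window
  Gibbs state of the balanced layer Hamiltonian `A = H - μ_L N` (window `Π` = sectors `(N_L, S^z = 0)` and
  `(N_L - 2, S^z = 0)`) has macroscopic `d`-wave pair coherence at imaginary-time separation `β_L / 2`,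
  `Re tr(Π e^{-β_L A/2} Δ_d Π e^{-β_L A/2} Δ_dᴴ) ≥ a L⁴ · Re tr(Π e^{-β_L A})` eventually in even `L`, then the
  window double has the uniform linear Josephson gain `a J L² ≤ E_L(0) - E_L(J)` for EVERY `J > 0`,
  eventually in even `L` (the let-telescope of clause (i) of `Theses.JosephsonMirror.JmCusp`, verbatim).
  Mechanism: the thermofield double `W = e^{-β_L A/2} Π` is a window state of norm `tr(Π e^{-β_L A})`,
  unperturbed energy `2 ⟨A⟩_{β_L, Π}` and interlayer coherence = the single-layer two-time coherence
  (`tfd_rayleigh`); the window floor is `E_L(0) = 2(e(N_L) - μ_L N_L)` (balancing `μ_L`); the entropy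
  price `⟨A⟩_{β_L,Π} - (e - μ_L N_L) ≤ log(4^{L²})/β_L = 2L² log 2/β_L` (`re_trace_proj_hamiltonian_gibbsWeight_le`)
  is `≤ a J L²/2` once `β_L ≥ 4 log 2/(a J)`.  No interchange of limits and no descent in `J` is involved.
* `jmCusp_of_coldPairCoherence_and_simple` — hence cold pair coherence at some `(U > 0, δ)` together with
  eventual simplicity of the `(N_L, S^z = 0)` floor there gives the crux `JmCusp` (with `J₀ = 1`).

By the landed normal form (`josephsonGain_iff_zeroExcessPairOrder`, p134917) the hypothesis is at least
zero-excess `d`-wave pair order at `(U, δ)` — the summit's open core — so this file is a reduction, not an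
engine: it is the socket a Euclidean (imaginary-time) construction of the doped layer would plug into.

Barriers (D-0021 bookkeeping).  `Literature.Barriers.HubbardSuperconductivity.PositiveTemperatureNoPairLRO`
(`not_hasTorusLRO_thermal_of_schedule`: no thermal pair torus-LRO along any schedule with
`log L / (1 + β_L |t|) → ∞`) is stated for the grand-canonical, equal-time, on-site pair two-point function,
so it does not literally apply to the canonical-window, two-time, bond-`d`-wave coherence assumed here; its
McBryan–Spencer mechanism is, however, insensitive to the pair form factor, and two-time coherence is bounded
by equal-time coherence (convexity in imaginary time, `GibbsTwoTimeBound`), so an engine for the hypothesis is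
expected to need `β_L ≳ log L`.  The implication proved here holds for EVERY schedule `β_L → ∞`; the entropy
price only asks `β_L ≥ 4 log 2 / (a J)` at fixed `J`.

Sources: Y. Takahashi, H. Umezawa, Collect. Phenom. 2 (1975) 55 (thermofield double); E. H. Lieb, PRL 62
(1989) 1201 (`W`-matrix packaging); H. Tasaki, *Physics and Mathematics of Quantum Many-Body Systems*
(2020) App. A (Gibbs variational principle); T. Koma, H. Tasaki, J. Stat. Phys. 76 (1994) 745.  No new
definitions (the hypothesis is spelled out on the tree's vocabulary).
-/

-- the mandated namespace `Summit.<Summit>.<Problem>.Theorems` repeats `HubbardSuperconductivity`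
-- (single-problem summit, D-0017), which the `dupNamespace` linter flags on every declaration
set_option linter.dupNamespace false

namespace Summit.HubbardSuperconductivity.HubbardSuperconductivity.Theorems.JosephsonMirror

open Matrix Literature.MathematicalPhysics.QuantumLattice
open Summit.HubbardSuperconductivity.HubbardSuperconductivity.Theses.JosephsonMirror (JmCusp)
open scoped Kronecker ComplexOrder

/-- A matrix whose nonzero entries never connect a block to its complement commutes with the block
indicator diagonal. [folklore] -/
theorem commute_diagonal_indicator_of_apply_ne_zero {ι : Type*} [Fintype ι] [DecidableEq ι]
    {M : Matrix ι ι ℂ} (P₁ : ι → Prop) [DecidablePred P₁] (h : ∀ s t, M s t ≠ 0 → (P₁ s ↔ P₁ t)) :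
    Commute M (diagonal fun s => if P₁ s then (1 : ℂ) else 0) := by
  change M * _ = _ * M
  ext s t
  rw [mul_diagonal, diagonal_mul]
  by_cases hM : M s t = 0
  · rw [hM, zero_mul, mul_zero]
  · have hst := h s t hM
    by_cases hs : P₁ s
    · rw [if_pos hs, if_pos (hst.1 hs), mul_one, one_mul]
    · rw [if_neg hs, if_neg (fun ht => hs (hst.2 ht)), mul_zero, zero_mul]

/-- The grand-canonical torus Hamiltonian `A = H - μ N` never connects a block `(2n, S^z = 0)` (as a
filtered-count predicate) to its complement: `H` preserves `(N↑, N↓)` and `N` is diagonal.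
Lieb, PRL 62 (1989) 1201. [folklore] -/
theorem hubbardTorusWith_apply_ne_zero_block_iff (L : ℕ) [NeZero L] (U μ : ℝ) (n : ℕ)
    (s t : Finset (Orb (FermionTorus 2 L))) (h : hubbardTorusWith 2 L 1 U μ s t ≠ 0) :
    (s.card = 2 * n ∧ (s.filter fun o => (ofLex o).2 = 0).card = (s.filter fun o => (ofLex o).2 = 1).card) ↔
      (t.card = 2 * n ∧ (t.filter fun o => (ofLex o).2 = 0).card =
        (t.filter fun o => (ofLex o).2 = 1).card) := by
  by_cases hst : s = t
  · rw [hst]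
  · have key : hubbardTorusWith 2 L 1 U μ s t = hubbardTorus 2 L 1 U s t := by
      rw [hubbardTorusWith_eq, Matrix.sub_apply, Matrix.smul_apply, LiebThm1.totalNumber_eq_diagonal]
      simp [hst]
    have hH : hubbardTorus 2 L 1 U s t ≠ 0 := by rwa [key] at h
    have hsec := LiebThm1.preservesSectors_hamiltonian (fermionTorusGraph 2 L) 1 U s t hH
    rw [block_iff, block_iff, hsec.1, hsec.2]

/-- **Cold imaginary-time `d`-wave pair coherence of one layer gives clause (i) of the bet** (the line of
the crux idea `thermofield-double-purification`, kernel-checked).  See the file docstring.  For `δ ∈ (0,1/2)`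
and `a > 0`: if along a schedule `β_L → ∞` the window Gibbs state of `A = hubbardTorusWith 2 L 1 U μ_L`
(window = sectors `(N_L, 0) ⊕ (N_L - 2, 0)`, balancing `μ_L`) has two-time `d`-wave pair coherence
`a L⁴ · Re tr(Π e^{-β_L A}) ≤ Re tr(Π e^{-β_L A/2} Δ_d Π e^{-β_L A/2} Δ_dᴴ)` eventually in even `L`, then for
every `J > 0`, eventually in even `L`, `a J L² ≤ E_L(0) - E_L(J)` for the window double (clause (i) of
`JmCusp` at `(U, δ)` with the same constant and any `J₀`).  Takahashi–Umezawa (1975); Lieb, PRL 62 (1989)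
1201; Tasaki (2020) App. A; Koma–Tasaki, J. Stat. Phys. 76 (1994) 745. [folklore] -/
theorem josephsonGain_of_coldPairCoherence : ∀ (U δ a : ℝ), δ ∈ Set.Ioo (0:ℝ) (1 / 2) → 0 < a → (∃ β : ℕ → ℝ, Filter.Tendsto β Filter.atTop Filter.atTop ∧ ∃ L₀ : ℕ, ∀ (L : ℕ) [NeZero L], Even L → L₀ ≤ L → (let ι : Type := Finset (Literature.MathematicalPhysics.QuantumLattice.Orb (Literature.MathematicalPhysics.QuantumLattice.FermionTorus 2 L)); let N : ℕ := 2 * ⌊(1 - δ) * (L : ℝ) ^ 2 / 2⌋₊; let H : Matrix ι ι ℂ := Literature.MathematicalPhysics.QuantumLattice.hubbardTorus 2 L 1 U; let μ : ℝ := (H.minEnergyOn (Literature.MathematicalPhysics.QuantumLattice.szSector N 0) - H.minEnergyOn (Literature.MathematicalPhysics.QuantumLattice.szSector (N - 2) 0)) / 2; let A : Matrix ι ι ℂ := Literature.MathematicalPhysics.QuantumLattice.hubbardTorusWith 2 L 1 U μ; let Δ : Matrix ι ι ℂ := Literature.MathematicalPhysics.QuantumLattice.pairField Literature.MathematicalPhysics.QuantumLattice.dWaveFormFactor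 L; let blk : ℕ → ι → Prop := fun n s => s.card = n ∧ (s.filter (fun o => (ofLex o).2 = 0)).card = (s.filter (fun o => (ofLex o).2 = 1)).card; let Pw : Matrix ι ι ℂ := Matrix.diagonal fun s => if blk N s ∨ blk (N - 2) s then 1 else 0; a * (L : ℝ) ^ 4 * (Pw * A.gibbsWeight (β L)).trace.re ≤ (Pw * A.gibbsWeight (β L / 2) * Δ * Pw * A.gibbsWeight (β L / 2) * Δᴴ).trace.re)) → ∀ J : ℝ, 0 < J → ∃ L₀ : ℕ, ∀ (L : ℕ) [NeZero L], Even L → L₀ ≤ L → (let ι : Type := Finset (Literature.MathematicalPhysics.QuantumLattice.Orb (Literature.MathematicalPhysics.QuantumLattice.FermionTorus 2 L)); let N : ℕ := 2 * ⌊(1 - δ) * (L : ℝ) ^ 2 / 2⌋₊; let H : Matrix ι ι ℂ := Literature.MathematicalPhysics.QuantumLattice.hubbardTorus 2 L 1 U; let μ : ℝ := (H.minEnergyOn (Literature.MathematicalPhysics.QuantumLattice.szSector N 0) - H.minEnergyOn (Literature.MathematicalPhysics.QuantumLattice.szSector (N - 2) 0)) / 2; let A : Matrix ι ι ℂ :=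 Literature.MathematicalPhysics.QuantumLattice.hubbardTorusWith 2 L 1 U μ; let D : Matrix ι ι ℂ := ((L : ℂ))⁻¹ • Literature.MathematicalPhysics.QuantumLattice.pairField Literature.MathematicalPhysics.QuantumLattice.dWaveFormFactor L; let Hd : ℝ → Matrix (ι × ι) (ι × ι) ℂ := fun J => Matrix.kroneckerMap (fun a b : ℂ => a * b) A 1 + Matrix.kroneckerMap (fun a b : ℂ => a * b) 1 (Matrix.transpose A) - (J : ℂ) • (Matrix.kroneckerMap (fun a b : ℂ => a * b) D (Matrix.transpose (Matrix.conjTranspose D)) + Matrix.kroneckerMap (fun a b : ℂ => a * b) (Matrix.conjTranspose D) (Matrix.transpose D)); let good : ι × ι → Prop := fun p => ((p.1.card = N ∧ p.2.card = N) ∨ (p.1.card = N - 2 ∧ p.2.card = N - 2)) ∧ (p.1.filter (fun o => (ofLex o).2 = 0)).card = (p.1.filter (fun o => (ofLex o).2 = 1)).card ∧ (p.2.filter (fun o => (ofLex o).2 = 0)).card = (p.2.filter (fun o => (ofLex o).2 = 1)).card; let S : Submodule ℂ (ι × ι → ℂ) := ⨅ (p : ι × ι) (_ : ¬ good p), LinearMap.ker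 (LinearMap.proj (R := ℂ) (φ := fun _ : ι × ι => ℂ) p); let E : ℝ → ℝ := fun J => (Hd J).minEnergyOn S; a * J * (L : ℝ) ^ 2 ≤ E 0 - E J) := by
  intro U δ a hδ ha hcoh J hJ
  obtain ⟨β, hβ, L₁, hcohL⟩ := hcoh
  -- cold enough sides: `β_L ≥ max 1 (4 log 2 / (a J))`
  obtain ⟨L₂, hL₂⟩ := Filter.eventually_atTop.1
    (Filter.tendsto_atTop.1 hβ (max 1 (4 * Real.log 2 / (a * J))))
  refine ⟨max L₁ L₂, ?_⟩
  intro L _ hE hL ι N H μ A D Hd good S E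
  have hL₁ : L₁ ≤ L := le_of_max_le_left hL
  have hβL : max 1 (4 * Real.log 2 / (a * J)) ≤ β L := hL₂ L (le_of_max_le_right hL)
  have hβ1 : 1 ≤ β L := (le_max_left _ _).trans hβL
  have hβpos : 0 < β L := lt_of_lt_of_le one_pos hβ1
  have hβb : 4 * Real.log 2 / (a * J) ≤ β L := (le_max_right _ _).trans hβL
  -- the filling: `N = 2n` with `1 ≤ n ≤ L²`
  set n : ℕ := ⌊(1 - δ) * (L : ℝ) ^ 2 / 2⌋₊ with hn
  have hNn : N = 2 * n := rfl
  have hL2 : (2 : ℝ) ≤ L := by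
    have h0 : L ≠ 0 := NeZero.ne L
    obtain ⟨k, hk⟩ := hE
    have : 2 ≤ L := by omega
    exact_mod_cast this
  have hn1 : 1 ≤ n := by
    rw [hn]
    refine Nat.le_floor ?_
    rw [Nat.cast_one, le_div_iff₀ (by norm_num : (0 : ℝ) < 2)]
    have hδ2 : 1 / 2 ≤ 1 - δ := by linarith [hδ.2]
    nlinarith [hδ2, hL2]
  have hnL : n ≤ L ^ 2 := by
    rw [hn]
    refine Nat.floor_le_of_le ?_
    have hδ0 : 1 - δ ≤ 1 := by linarith [hδ.1]
    have hL0 : (0 : ℝ) ≤ (L : ℝ) ^ 2 := by positivity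
    push_cast
    nlinarith
  have hn'L : n - 1 ≤ L ^ 2 := le_trans (Nat.sub_le n 1) hnL
  have hN2 : N - 2 = 2 * (n - 1) := by omega
  have hN2' : ((N - 2 : ℕ) : ℝ) = (N : ℝ) - 2 := by
    rw [Nat.cast_sub (by omega)]
    norm_num
  -- energies and the balancing chemical potential
  set e₁ : ℝ := H.minEnergyOn (szSector N 0) with he₁
  set e₂ : ℝ := H.minEnergyOn (szSector (N - 2) 0) with he₂
  have hμ : μ = (e₁ - e₂) / 2 := rfl
  set a₀ : ℝ := e₁ - μ * N with ha₀
  have ha₂ : a₀ = e₂ - μ * ((N - 2 : ℕ) : ℝ) := by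
    rw [hN2', ha₀, hμ]
    ring
  have hAherm : A.IsHermitian := isHermitian_hamiltonianWith _ 1 U μ
  -- block predicates
  set F : ι → Prop := fun s =>
    (s.filter fun o => (ofLex o).2 = 0).card = (s.filter fun o => (ofLex o).2 = 1).card with hF
  set P₁ : ι → Prop := fun s => s.card = N ∧ F s with hP₁
  set P₂ : ι → Prop := fun s => s.card = N - 2 ∧ F s with hP₂
  have h12 : ∀ s, P₁ s → ¬ P₂ s := by
    rintro s ⟨h1, -⟩ ⟨h2, -⟩
    omega
  have hgood : ∀ s t, good (s, t) → (P₁ s ∧ P₁ t) ∨ (P₂ s ∧ P₂ t) := by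
    rintro s t ⟨h | h, hs, ht⟩
    · exact Or.inl ⟨⟨h.1, hs⟩, ⟨h.2, ht⟩⟩
    · exact Or.inr ⟨⟨h.1, hs⟩, ⟨h.2, ht⟩⟩
  have hgood₁ : ∀ s t, P₁ s → P₁ t → good (s, t) := fun s t hs ht =>
    ⟨Or.inl ⟨hs.1, ht.1⟩, hs.2, ht.2⟩
  have hgood₂ : ∀ s t, P₂ s → P₂ t → good (s, t) := fun s t hs ht =>
    ⟨Or.inr ⟨hs.1, ht.1⟩, hs.2, ht.2⟩
  have hS : ∀ ψ, ψ ∈ S ↔ ∀ p, ¬ good p → ψ p = 0 := by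
    intro ψ
    simp only [S, Submodule.mem_iInf, LinearMap.mem_ker, LinearMap.proj_apply]
  -- Rayleigh floors on the two blocks
  have hA₁ : ∀ v : ι → ℂ, (∀ s, ¬ P₁ s → v s = 0) →
      a₀ * (star v ⬝ᵥ v).re ≤ (star v ⬝ᵥ A *ᵥ v).re := by
    intro v hv
    have h := block_rayleigh_lower L U μ hnL v (by simpa [hP₁, hF, hNn] using hv)
    rw [ha₀, hNn]
    exact h
  have hA₂ : ∀ v : ι → ℂ, (∀ s, ¬ P₂ s → v s = 0) →
      a₀ * (star v ⬝ᵥ v).re ≤ (star v ⬝ᵥ A *ᵥ v).re := by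
    intro v hv
    have h := block_rayleigh_lower L U μ hn'L v (by simpa [hP₂, hF, hN2] using hv)
    rw [← hN2] at h
    rw [ha₂]
    exact h
  -- the blocks are invariant under `A`
  have hc₁ : Commute A (diagonal fun s => if P₁ s then (1 : ℂ) else 0) := by
    refine commute_diagonal_indicator_of_apply_ne_zero P₁ fun s t hst => ?_
    have h := hubbardTorusWith_apply_ne_zero_block_iff L U μ n s t hst
    simpa [hP₁, hF, hNn] using h
  have hc₂ : Commute A (diagonal fun s => if P₂ s then (1 : ℂ) else 0) := by
    refine commute_diagonal_indicator_of_apply_ne_zero P₂ fun s t hst => ?_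
    have h := hubbardTorusWith_apply_ne_zero_block_iff L U μ (n - 1) s t hst
    simpa [hP₂, hF, hN2] using h
  -- a unit ground state of the first block attains the floor `a₀`
  have hcard : n ≤ Fintype.card (FermionTorus 2 L) := by rwa [card_fermionTorus]
  obtain ⟨⟨φ, hφmem, hφ0, hHφ⟩, -⟩ := szSector_groundState (fermionTorusGraph 2 L) 1 U hcard
  obtain ⟨c, -, hc1⟩ := exists_smul_unit hφ0
  set v : ι → ℂ := c • φ with hv
  have hvmem : v ∈ szSector N 0 := by rw [hNn]; exact Submodule.smul_mem _ c hφmem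
  have hvsec : IsInSector n n v := (mem_szSector_two_mul_zero_iff n v).1 (hNn ▸ hvmem)
  have hvP : ∀ s, ¬ P₁ s → v s = 0 := fun s hs =>
    hvsec s fun h => hs (by simpa [hP₁, hF, hNn] using (block_iff n s).2 h)
  have hvN : IsNParticle N v := (mem_szSector_iff N 0 v).1 hvmem |>.1
  have hHv : H *ᵥ v = (e₁ : ℂ) • v := by
    change hubbardTorus 2 L 1 U *ᵥ (c • φ) = (e₁ : ℂ) • (c • φ)
    rw [mulVec_smul]
    change c • (hamiltonian (fermionTorusGraph 2 L) 1 U *ᵥ φ) = _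
    rw [hHφ, smul_comm, he₁, hNn]
    rfl
  have hAv : A *ᵥ v = (a₀ : ℂ) • v := by
    change hubbardTorusWith 2 L 1 U μ *ᵥ v = (a₀ : ℂ) • v
    rw [hubbardTorusWith_eq, sub_mulVec, smul_mulVec, totalNumber_mulVec_of_isNParticle hvN,
      smul_smul]
    change H *ᵥ v - _ = _
    rw [hHv, ← sub_smul, ha₀]
    push_cast
    rfl
  have hatt : ∃ w : ι → ℂ, (∀ s, ¬ P₁ s → w s = 0) ∧ star w ⬝ᵥ w = 1 ∧ (star w ⬝ᵥ A *ᵥ w).re ≤ a₀ := by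
    refine ⟨v, hvP, hc1, le_of_eq ?_⟩
    rw [hAv, dotProduct_smul, hc1, smul_eq_mul, mul_one, Complex.ofReal_re]
  -- the abstract thermofield bound at `β_L`
  have key := tfd_gain_lower hAherm D P₁ P₂ h12 good hgood hgood₁ hgood₂ S hS hc₁ hc₂ a₀ hA₁ hA₂
    hatt hβpos J
  set Pw : Matrix ι ι ℂ := diagonal fun s => if P₁ s ∨ P₂ s then (1 : ℂ) else 0 with hPw
  set Z : ℝ := (Pw * gibbsWeight (β L) A).trace.re with hZdef
  set CD : ℝ := (Pw * gibbsWeight (β L / 2) A * D * Pw * gibbsWeight (β L / 2) A * Dᴴ).trace.re with hCD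
  set C : ℝ := (Pw * gibbsWeight (β L / 2) A * pairField dWaveFormFactor L * Pw *
    gibbsWeight (β L / 2) A * (pairField dWaveFormFactor L)ᴴ).trace.re with hCdef
  -- the hypothesis at `L`
  have hC : a * (L : ℝ) ^ 4 * Z ≤ C := hcohL L hE hL₁
  -- `D = L⁻¹ Δ_d`
  have hL0 : (0 : ℝ) < L := by linarith
  have hDdef : D = ((L : ℂ))⁻¹ • pairField dWaveFormFactor L := rfl
  have hDH : Dᴴ = ((L : ℂ))⁻¹ • (pairField dWaveFormFactor L)ᴴ := by
    rw [hDdef, conjTranspose_smul, Complex.star_def, map_inv₀, Complex.conj_natCast]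
  have hcc : ((L : ℂ))⁻¹ * ((L : ℂ))⁻¹ = ((((L : ℝ) ^ 2)⁻¹ : ℝ) : ℂ) := by
    push_cast
    ring
  have hCD' : CD = ((L : ℝ) ^ 2)⁻¹ * C := by
    rw [hCD, hCdef, hDH, hDdef]
    simp only [mul_smul_comm, smul_mul_assoc, smul_smul, trace_smul, smul_eq_mul]
    rw [hcc, Complex.re_ofReal_mul]
  have h1 : a * (L : ℝ) ^ 2 * Z ≤ CD := by
    rw [hCD']
    have hL2pos : (0 : ℝ) < (L : ℝ) ^ 2 := by positivity
    rw [le_inv_mul_iff₀ hL2pos]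
    nlinarith [hC]
  -- the entropy price: `log (card ι) = 2 L² log 2`
  have hcard : Real.log (Fintype.card ι) = 2 * (L : ℝ) ^ 2 * Real.log 2 := by
    have h : Fintype.card ι = 2 ^ (2 * L ^ 2) := by
      change Fintype.card (Finset (Orb (FermionTorus 2 L))) = _
      rw [Fintype.card_finset, card_orb, card_fermionTorus]
    rw [h, Nat.cast_pow, Real.log_pow]
    push_cast
    ring
  have hlog2 : 0 < Real.log 2 := Real.log_pos one_lt_two
  have h2 : 2 * (Real.log (Fintype.card ι) / β L) ≤ a * J * (L : ℝ) ^ 2 := by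
    rw [hcard]
    have haJ : 0 < a * J := mul_pos ha hJ
    rw [div_le_iff₀ haJ] at hβb
    rw [mul_div_assoc', div_le_iff₀ hβpos]
    have hL2nn : (0 : ℝ) ≤ (L : ℝ) ^ 2 := by positivity
    nlinarith [hβb, hL2nn]
  -- `Z > 0`: the window is nonempty and `e^{-βA}` has positive diagonal
  have hZpos : 0 < Z := by
    have hv0 : v ≠ 0 := by
      intro h
      rw [h, dotProduct_zero] at hc1
      exact zero_ne_one hc1
    obtain ⟨s₀, hs₀⟩ := Function.ne_iff.1 hv0
    have hP₁s₀ : P₁ s₀ := by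
      by_contra h
      exact hs₀ (hvP s₀ h)
    have hdiag : ∀ s, 0 ≤ ((if P₁ s ∨ P₂ s then (1 : ℂ) else 0) * gibbsWeight (β L) A s s).re := by
      intro s
      by_cases h : P₁ s ∨ P₂ s
      · rw [if_pos h, one_mul]
        exact (Complex.pos_iff.mp ((posDef_gibbsWeight (β L) hAherm).diag_pos (i := s))).1.le
      · rw [if_neg h, zero_mul, Complex.zero_re]
    have hs₀pos : 0 < ((if P₁ s₀ ∨ P₂ s₀ then (1 : ℂ) else 0) * gibbsWeight (β L) A s₀ s₀).re := by
      rw [if_pos (Or.inl hP₁s₀), one_mul]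
      exact (Complex.pos_iff.mp ((posDef_gibbsWeight (β L) hAherm).diag_pos (i := s₀))).1
    rw [hZdef, hPw, trace, Complex.re_sum]
    simp only [diag_apply, diagonal_mul]
    exact lt_of_lt_of_le hs₀pos (Finset.single_le_sum (fun s _ => hdiag s) (Finset.mem_univ s₀))
  -- assemble
  have key2 : 2 * J * CD - 2 * (Real.log (Fintype.card ι) / β L) * Z ≤ (E 0 - E J) * Z := key
  have h3 : a * J * (L : ℝ) ^ 2 * Z ≤ (E 0 - E J) * Z := by
    nlinarith [key2, mul_le_mul_of_nonneg_left h1 (by positivity : (0 : ℝ) ≤ 2 * J),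
      mul_le_mul_of_nonneg_right h2 hZpos.le]
  exact le_of_mul_le_mul_right h3 hZpos

/-- **The thermofield line of the bet.**  If at some `U > 0`, `δ ∈ (0, 1/2)`, `a > 0` the balanced layer has
cold imaginary-time `d`-wave pair coherence along a schedule `β_L → ∞` (hypothesis of
`josephsonGain_of_coldPairCoherence`) AND the `(N_L, S^z = 0)` ground state of `hubbardTorus 2 L 1 U` is
eventually simple (clause (ii) of the crux, verbatim), then `JmCusp` holds (with the same `a` and `J₀ = 1`).
This is the composition `TfdLine` of the crux idea `thermofield-double-purification`; by the normal form
`josephsonGain_iff_zeroExcessPairOrder` its first hypothesis is at least zero-excess `d`-wave pair order at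
`(U, δ)`, so nothing here claims the crux.  Takahashi–Umezawa (1975); Lieb, PRL 62 (1989) 1201;
Koma–Tasaki, J. Stat. Phys. 76 (1994) 745. [folklore] -/
theorem jmCusp_of_coldPairCoherence_and_simple
    (h : ∃ U : ℝ, 0 < U ∧ ∃ δ ∈ Set.Ioo (0:ℝ) (1 / 2), ∃ a : ℝ, 0 < a ∧
      (∃ β : ℕ → ℝ, Filter.Tendsto β Filter.atTop Filter.atTop ∧ ∃ L₀ : ℕ, ∀ (L : ℕ) [NeZero L], Even L → L₀ ≤ L → (let ι : Type := Finset (Literature.MathematicalPhysics.QuantumLattice.Orb (Literature.MathematicalPhysics.QuantumLattice.FermionTorus 2 L)); let N : ℕ := 2 * ⌊(1 - δ) * (L : ℝ) ^ 2 / 2⌋₊; let H : Matrix ι ι ℂ := Literature.MathematicalPhysics.QuantumLattice.hubbardTorus 2 L 1 U; let μ : ℝ := (H.minEnergyOn (Literature.MathematicalPhysics.QuantumLattice.szSector N 0) - H.minEnergyOn (Literature.MathematicalPhysics.QuantumLattice.szSector (N - 2) 0)) / 2; let A : Matrix ι ι ℂ := Literature.MathematicalPhysics.QuantumLattice.hubbardTorusWith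 2 L 1 U μ; let Δ : Matrix ι ι ℂ := Literature.MathematicalPhysics.QuantumLattice.pairField Literature.MathematicalPhysics.QuantumLattice.dWaveFormFactor L; let blk : ℕ → ι → Prop := fun n s => s.card = n ∧ (s.filter (fun o => (ofLex o).2 = 0)).card = (s.filter (fun o => (ofLex o).2 = 1)).card; let Pw : Matrix ι ι ℂ := Matrix.diagonal fun s => if blk N s ∨ blk (N - 2) s then 1 else 0; a * (L : ℝ) ^ 4 * (Pw * A.gibbsWeight (β L)).trace.re ≤ (Pw * A.gibbsWeight (β L / 2) * Δ * Pw * A.gibbsWeight (β L / 2) * Δᴴ).trace.re)) ∧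
      (∃ L₀ : ℕ, ∀ (L : ℕ), Even L → L₀ ≤ L → ∀ φ φ' : Fock (Orb (FermionTorus 2 L)),
        IsGroundStateInSector (hubbardTorus 2 L 1 U) (2 * ⌊(1 - δ) * (L : ℝ) ^ 2 / 2⌋₊) 0 φ →
        IsGroundStateInSector (hubbardTorus 2 L 1 U) (2 * ⌊(1 - δ) * (L : ℝ) ^ 2 / 2⌋₊) 0 φ' →
        ∃ c : ℂ, φ' = c • φ)) :
    JmCusp := by
  obtain ⟨U, hU, δ, hδ, a, ha, hcoh, hS⟩ := h
  have hG := josephsonGain_of_coldPairCoherence U δ a hδ ha hcoh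
  unfold JmCusp
  exact ⟨U, hU, δ, hδ, a, ha, 1, one_pos, fun J hJ => hG J hJ.1, hS⟩

end Summit.HubbardSuperconductivity.HubbardSuperconductivity.Theorems.JosephsonMirror
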